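import Summits.QuantumFields.BalabanUV.Beta.EriceFlowEnclosureB12AsPrintedPointwiseFadingOrder
import Summits.QuantumFields.BalabanUV.Beta.EriceFlowEnclosureB12AsPrintedPointwiseWitness

/-!
# Beta / EriceFlowEnclosureB12AsPrintedPointwiseFadingSignFamily — WHAT (0.31) FORCES POINTWISE, witness part 8a: THE RAMP FAMILY.  A two-coupling family INSIDE node U2's
# coupling-chart regime ([I] p. 298: β_{j} *"depends also on all preceding coupling constants"*): β_1 ≡ 1, β_2(g₀, g₁) = g₁·(2g₁ − g₀), β_{k+1} ≡ 1 (k ≥ 2) — polynomial, hence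
# `HistLipschitz Λ γ` on every box with Λ 1 i = 5γ (else 0) and `FadingMemory (5γ∕θ) θ Λ` for every 0 < θ ≤ 1, (U) `BetaUpperH 1 (1∕2)`, (C), p. 264's clause box-wide, `hrg`.  Along
# every run of (0.20) the couplings increase (β_1 = 1 > 0), so at scale 1 the run history has g₁ > g₀ and β_2 = g₁(2g₁ − g₀) > g₁² > 0 — TINY near zero coupling; and [I] THEOREM 2
# AS TYPED holds for every setting carrying the family (the run ending at g on the lattice K ≥ 2 has levels 1∕g² + (K − k) for k ≥ 2, its scale-1 level is the root y₁ ∈ [Y, Y + 1]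
# of y − φ(y) = Y := 1∕g² + (K − 2), φ(y) = y^{−1∕2}(2y^{−1∕2} − (y+1)^{−1∕2}) ∈ [1∕y, 1∕2], found by the intermediate value theorem; (0.31) with β ln L = min(½, g²∕2) — the
# K = 2 lattice forces the g-dependence — and β′ ln L = 2), while OFF the runs, at the box history (δ, δ∕3) ∈ ]0, δ]², β_2 = −δ²∕9 < 0: ¬`FlowStep.BetaSignH` inside EVERY box.  So, with
# part 7 (uniqueness free) and part 8 (`…PointwiseFadingSign`: the typed Theorem 2 forces β ≥ −(C∕(1−θ))δ on ]0, δ]^{k+1}): UNDER FADING MEMORY THE TYPED THEOREM 2 DOES NOT FORCE THE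
# SIGN LETTER — contrast part 1 (#59a `betaSignH_of_theorem2_markov`) and part 5 (#60a `betaSignH_of_theorem2_unique_markov`): there the MARKOV letter is load-bearing, even given
# node U2's moduli and uniqueness.  Part 8b `…PointwiseFadingSignWitness` builds the def-free SETTING with [I]'s whole typed content
# (β-flow team, prover 2 = lower ∕ positivity side, unit `b2b-balaban-beta-bflow-p2`, gen 44; ROW AP-I × node U2's letters)

HONEST FRAMING (page 1 of everything the β sub-cell writes): discharging `BetaPertH` makes Bałaban's UV stability UNCONDITIONAL — a
real constructive-QFT result; it is NOT the continuum limit and NOT the Clay problem.  HONEST DEPENDENCY (cell reorg 2026-08-19,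
verbatim): «continuum YM on T⁴ ⇐ BetaPertH ∧ nine spine estimates (0/9 proved); BetaPertH ⇐ (D1) ∧ (D4) ∧ CAP+tail; G-an2-4 gates
asym, D1 and NE2/3/4.»  THIS MODULE DISCHARGES NOTHING and says NOTHING about Bałaban's objects: a toy family of ours entering through the DEFINING HYPOTHESIS `hβ` (on the
β of an abstract `B12BetaAsPrinted.Setting S`); `Theorem2Statement` ([I] = T. Bałaban, Commun. Math. Phys. **109** (1987) [Balaban1987RG1] Theorem 2, STATED WITHOUT PROOF, p. 259) is
PROVED for such settings from the printed `Definitions` (runs identified with the explicit chain by (0.20)'s forward determination, `…PointwiseWitness.cpl_eq_of_rgEqH`); node U2's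
`T4CouplingMatching.HistLipschitz` ∕ `FadingMemory` are HYPOTHESIS SHAPES (NOT printed; GAPS G-t4-U2-2), here VERIFIED for the toy.

WHAT THIS FILE PROVES (0 sorry, 0 def): §1 `beta_of_ne_one`, `beta_one`, `abs_beta_le_one` (|β| ≤ 1 on the closed box of side ½), `continuous_beta`, **`letters_ramp`** ((U) `BetaUpperH 1 (1∕2)`,
(C) every γ, `BetaSmoothInLast264` every γ, `hrg` on ]0, ½]), **`histLipschitz_ramp`**, **`fadingMemory_ramp`**, **`not_betaSignH_ramp`**; §2 `phi_bounds`, `level_one_exists` (IVT),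
**`rampChain_exists`** (the explicit ∕ IVT run with
(0.31) at (min(½, g²∕2), 2)), **`theorem2_typed_ramp`** (THEOREM 2 AS TYPED), **`not_uniform_ramp`** (its g-UNIFORM form FAILS — else part 6's END would give `BetaAFH`), `localUnique_ramp` (part 7:
uniqueness on ]0, g₂] for some g₂ > 0, free).
NOT CLAIMED: that the family resembles Bałaban's (1.22); any letter for it; Theorem 2; `BetaPertH`; continuum; Clay.
-/

namespace Summit.QuantumFields.BalabanUV.Beta.EriceFlowEnclosureB12AsPrintedPointwiseFadingSignFamily

open Literature.MathematicalPhysics.QuantumFieldTheory.Balaban1983to89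
open Literature.MathematicalPhysics.QuantumFieldTheory.Balaban1983to89.B12BetaAsPrinted
open Literature.MathematicalPhysics.QuantumFieldTheory.Balaban1983to89.B12CouplingClausesHistory (BetaSmoothInLast264)
open Literature.MathematicalPhysics.QuantumFieldTheory.Balaban1983to89.FlowStep (HBeta prefixOf Box mem_box box_mono RGEqH BetaUpperH BetaLowerH
  BetaContH BetaSignH BetaAFH betaSignH_of_AFH)
open Literature.MathematicalPhysics.QuantumFieldTheory.Balaban1983to89.T4CouplingMatching (HistLipschitz FadingMemory)
open Summit.QuantumFields.BalabanUV.Beta.EriceFlowEnclosureB12AsPrintedTunedUpper (hrg_of_betaUpperH)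
open Summit.QuantumFields.BalabanUV.Beta.EriceFlowEnclosureB12AsPrintedLowerEnd (theorem2Statement_iff_noInterval)
open Summit.QuantumFields.BalabanUV.Beta.EriceFlowEnclosureB12AsPrintedPointwiseWitness (cpl_eq_of_rgEqH)
open Summit.QuantumFields.BalabanUV.Beta.EriceFlowEnclosureB12AsPrintedPointwiseFading (betaAFH_of_uniformTheorem2_fadingMemory)
open Summit.QuantumFields.BalabanUV.Beta.EriceFlowEnclosureB12AsPrintedPointwiseFadingOrder (localUnique_signFree)

noncomputable section

section Family

variable {S : Setting}
  (hβ : ∀ (k : ℕ) (p : Fin (k + 1) → ℝ),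
    S.β k p = if k = 1 then p (Fin.last k) * (2 * p (Fin.last k) - p 0) else 1)
include hβ

/-! ## §1 The ramp family: values, letters, moduli, no sign -/

/-- Off scale 1 the family is the constant 1. [folklore] -/
theorem beta_of_ne_one {k : ℕ} (hk : k ≠ 1) (p : Fin (k + 1) → ℝ) : S.β k p = 1 := by
  rw [hβ, if_neg hk]

/-- At scale 1: β_2(g₀, g₁) = g₁·(2g₁ − g₀). [folklore] -/
theorem beta_one (p : Fin (1 + 1) → ℝ) : S.β 1 p = p 1 * (2 * p 1 - p 0) := by
  rw [hβ, if_pos rfl]; rfl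

/-- |β_{k+1}| ≤ 1 whenever the first and the last coupling lie in [0, ½] (the closed box: the run histories of (1.18)∕(5.44)'s sections included). [folklore] -/
theorem abs_beta_le_one {k : ℕ} {p : Fin (k + 1) → ℝ} (h0 : 0 ≤ p 0) (h0' : p 0 ≤ 1 / 2)
    (hl : 0 ≤ p (Fin.last k)) (hl' : p (Fin.last k) ≤ 1 / 2) : |S.β k p| ≤ 1 := by
  rw [hβ]
  split_ifs
  · rw [abs_mul]
    have h1 : |p (Fin.last k)| ≤ 1 / 2 := abs_le.mpr ⟨by linarith, hl'⟩
    have h2 : |2 * p (Fin.last k) - p 0| ≤ 1 := abs_le.mpr ⟨by linarith, by linarith⟩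
    calc |p (Fin.last k)| * |2 * p (Fin.last k) - p 0| ≤ 1 / 2 * 1 :=
          mul_le_mul h1 h2 (abs_nonneg _) (by norm_num)
      _ ≤ 1 := by norm_num
  · simp

/-- Each β_{k+1} is continuous on all of ℝ^{k+1} (a polynomial). [folklore] -/
theorem continuous_beta (k : ℕ) : Continuous fun p : Fin (k + 1) → ℝ => S.β k p := by
  by_cases hk : k = 1
  · have e : (fun p : Fin (k + 1) → ℝ => S.β k p) =
        fun p => p (Fin.last k) * (2 * p (Fin.last k) - p 0) := funext fun p => by rw [hβ, if_pos hk]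
    rw [e]
    exact (continuous_apply _).mul ((continuous_const.mul (continuous_apply _)).sub (continuous_apply _))
  · have e : (fun p : Fin (k + 1) → ℝ => S.β k p) = fun _ => (1 : ℝ) := funext fun p => by rw [hβ, if_neg hk]
    rw [e]; exact continuous_const

/-- **THE LETTERS**: (U) `BetaUpperH 1 (1∕2)`; (C) `BetaContH γ` for every γ; p. 264's clause box-wide `BetaSmoothInLast264 γ` for every γ (polynomial ∕ constant sections); and with the
printed `Definitions` the binder `hrg` on ]0, ½] (`hrg_of_betaUpperH`, 1·(½)² < 1). [cite: Balaban1987RG1, (0.20) p.256 and p.264] -/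
theorem letters_ramp : BetaUpperH 1 (1 / 2) S.β ∧ (∀ γ : ℝ, BetaContH γ S.β) ∧ (∀ γ : ℝ, BetaSmoothInLast264 γ S.β) ∧
    (Definitions S → ∀ P : B12.RunParams, Step.InInterval (1 / 2) P.K (S.cpl P) → RGEqH P.K S.β (S.cpl P)) := by
  have hup : BetaUpperH 1 (1 / 2) S.β := fun k p hp => by
    have h0 := (mem_box.mp hp) 0
    have hl := (mem_box.mp hp) (Fin.last k)
    exact (le_abs_self _).trans (abs_beta_le_one hβ h0.1.le h0.2 hl.1.le hl.2)
  refine ⟨hup, fun γ k => (continuous_beta hβ k).continuousOn, fun γ k p _ n => ?_,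
    fun hD => hrg_of_betaUpperH hD (by norm_num) hup (by norm_num)⟩
  by_cases hk : k = 1
  · subst hk
    have hne : ((0 : Fin (1 + 1))) ≠ Fin.last 1 := by decide
    have e : (fun s : ℝ => S.β 1 (Function.update p (Fin.last 1) s)) = fun s => s * (2 * s - p 0) := by
      funext s
      rw [hβ, if_pos rfl, Function.update_self, Function.update_of_ne hne]
    rw [e]
    exact (contDiff_id.mul ((contDiff_const.mul contDiff_id).sub contDiff_const)).contDiffOn
  · have e : (fun s : ℝ => S.β k (Function.update p (Fin.last k) s)) = fun _ => (1 : ℝ) := funext fun s => by rw [hβ, if_neg hk]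
    rw [e]; exact contDiffOn_const

/-- **COUPLING-CHART HISTORY MODULI**: on every box ]0, γ]^{k+1} (γ ≥ 0), `HistLipschitz Λ γ S.β` with Λ 1 i = 5γ and Λ k i = 0 for k ≠ 1
(β_2(p) − β_2(q) = 2(p₁ + q₁)(p₁ − q₁) − p₀(p₁ − q₁) − q₁(p₀ − q₀)). [folklore] -/
theorem histLipschitz_ramp {γ : ℝ} (hγ : 0 ≤ γ) : HistLipschitz (fun k _ => if k = 1 then 5 * γ else 0) γ S.β := by
  intro k p q hp hq
  by_cases hk : k = 1
  · subst hk
    simp only [if_true]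
    rw [beta_one hβ, beta_one hβ, Fin.sum_univ_two]
    have hp0 := (mem_box.mp hp) 0
    have hp1 := (mem_box.mp hp) 1
    have hq0 := (mem_box.mp hq) 0
    have hq1 := (mem_box.mp hq) 1
    have key : p 1 * (2 * p 1 - p 0) - q 1 * (2 * q 1 - q 0)
        = (2 * (p 1 + q 1) - p 0) * (p 1 - q 1) - q 1 * (p 0 - q 0) := by ring
    rw [key]
    have hA : |2 * (p 1 + q 1) - p 0| ≤ 4 * γ := abs_le.mpr ⟨by linarith, by linarith⟩
    have hB : |q 1| ≤ γ := abs_le.mpr ⟨by linarith, hq1.2⟩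
    calc |(2 * (p 1 + q 1) - p 0) * (p 1 - q 1) - q 1 * (p 0 - q 0)|
        ≤ |(2 * (p 1 + q 1) - p 0) * (p 1 - q 1)| + |q 1 * (p 0 - q 0)| := abs_sub _ _
      _ = |2 * (p 1 + q 1) - p 0| * |p 1 - q 1| + |q 1| * |p 0 - q 0| := by rw [abs_mul, abs_mul]
      _ ≤ 4 * γ * |p 1 - q 1| + γ * |p 0 - q 0| :=
          add_le_add (mul_le_mul_of_nonneg_right hA (abs_nonneg _)) (mul_le_mul_of_nonneg_right hB (abs_nonneg _))
      _ ≤ 5 * γ * |((p : Fin (1 + 1) → ℝ)) 0 - q 0| + 5 * γ * |p 1 - q 1| := by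
          nlinarith [abs_nonneg (p 0 - q 0), abs_nonneg (p 1 - q 1)]
  · rw [beta_of_ne_one hβ hk, beta_of_ne_one hβ hk, sub_self, abs_zero]
    exact Finset.sum_nonneg fun i _ => mul_nonneg (by simp [hk]) (abs_nonneg _)

omit hβ in
/-- … with FADING MEMORY at every rate 0 < θ ≤ 1: `FadingMemory (5γ∕θ) θ Λ` (the only nonzero moduli are Λ 1 0 = 5γ ≤ (5γ∕θ)·θ and Λ 1 1 = 5γ ≤ 5γ∕θ). [folklore] -/
theorem fadingMemory_ramp {γ θ : ℝ} (hγ : 0 ≤ γ) (hθ0 : 0 < θ) (hθ1 : θ ≤ 1) :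
    FadingMemory (5 * γ / θ) θ (fun k _ => if k = 1 then 5 * γ else 0) := by
  intro k i hik
  have hC : 0 ≤ 5 * γ / θ := by positivity
  by_cases hk : k = 1
  · subst hk
    simp only [if_true]
    refine ⟨by positivity, ?_⟩
    interval_cases i
    · rw [Nat.sub_zero, pow_one, div_mul_cancel₀ _ hθ0.ne']
    · rw [Nat.sub_self, pow_zero, mul_one, le_div_iff₀ hθ0]; nlinarith
  · simp only [hk, if_false]
    exact ⟨le_rfl, by positivity⟩

/-- **NO SIGN**: β_2(δ, δ∕3) = −δ²∕9 < 0 at a history inside EVERY box ]0, δ]² — a history no run visits (runs have g₁ > g₀). [folklore] -/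
theorem not_betaSignH_ramp : ¬ BetaSignH S.β := by
  rintro ⟨δ, hδ, hlo⟩
  have hp : (![δ, δ / 3] : Fin (1 + 1) → ℝ) ∈ Box δ 1 := by
    rw [mem_box]; intro i; fin_cases i
    · exact ⟨hδ, le_rfl⟩
    · exact ⟨by simp; positivity, by simp; linarith⟩
  have h := hlo 1 _ hp
  rw [beta_one hβ] at h
  simp at h
  nlinarith

/-! ## §2 The runs: the explicit ∕ IVT chain, Theorem 2 as typed, its uniform form fails, uniqueness is free -/

omit hβ in
/-- The scale-1 increment along a run as a function of the scale-1 level y = 1∕g₁² (bare level y + 1): φ(y) = y^{−1∕2}(2y^{−1∕2} − (y+1)^{−1∕2}) lies in [1∕y, 1∕2] for y ≥ 4,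
and y ↦ y − φ(y) is continuous on [Y, Y + 1] for Y ≥ 4. [folklore] -/
theorem phi_bounds {y : ℝ} (hy : 4 ≤ y) :
    1 / y ≤ 1 / Real.sqrt y * (2 * (1 / Real.sqrt y) - 1 / Real.sqrt (y + 1)) ∧
      1 / Real.sqrt y * (2 * (1 / Real.sqrt y) - 1 / Real.sqrt (y + 1)) ≤ 1 / 2 := by
  have hy0 : 0 < y := by linarith
  have hs : 0 < Real.sqrt y := Real.sqrt_pos.mpr hy0
  have hs1 : 0 < Real.sqrt (y + 1) := Real.sqrt_pos.mpr (by linarith)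
  have hss : Real.sqrt y ≤ Real.sqrt (y + 1) := Real.sqrt_le_sqrt (by linarith)
  have hinv : 1 / Real.sqrt (y + 1) ≤ 1 / Real.sqrt y := one_div_le_one_div_of_le hs hss
  have hsq : 1 / Real.sqrt y * (1 / Real.sqrt y) = 1 / y := by
    rw [div_mul_div_comm, one_mul, Real.mul_self_sqrt hy0.le]
  have h2 : (2 : ℝ) ≤ Real.sqrt y := by
    rw [show (2 : ℝ) = Real.sqrt 4 by rw [show (4 : ℝ) = 2 ^ 2 by norm_num, Real.sqrt_sq (by norm_num)]]
    exact Real.sqrt_le_sqrt hy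
  have hinv2 : 1 / Real.sqrt y ≤ 1 / 2 := one_div_le_one_div_of_le (by norm_num) h2
  constructor
  · calc 1 / y = 1 / Real.sqrt y * (2 * (1 / Real.sqrt y) - 1 / Real.sqrt y) := by rw [← hsq]; ring
      _ ≤ _ := mul_le_mul_of_nonneg_left (by linarith) (by positivity)
  · calc 1 / Real.sqrt y * (2 * (1 / Real.sqrt y) - 1 / Real.sqrt (y + 1))
        ≤ 1 / Real.sqrt y * (2 * (1 / Real.sqrt y)) := mul_le_mul_of_nonneg_left (by linarith [one_div_pos.mpr hs1]) (by positivity)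
      _ = 2 * (1 / Real.sqrt y * (1 / Real.sqrt y)) := by ring
      _ ≤ 2 * (1 / 2 * (1 / 2)) := by rw [hsq]; nlinarith [one_div_pos.mpr hs, hinv2]
      _ ≤ 1 / 2 := by norm_num

omit hβ in
/-- The scale-1 level of the run on a lattice K ≥ 2: a root y₁ ∈ [Y, Y + 1] of y − φ(y) = Y (intermediate value theorem; Y ≥ 4). [folklore] -/
theorem level_one_exists {Y : ℝ} (hY : 4 ≤ Y) :
    ∃ y₁ : ℝ, Y ≤ y₁ ∧ y₁ ≤ Y + 1 ∧ y₁ = Y + 1 / Real.sqrt y₁ * (2 * (1 / Real.sqrt y₁) - 1 / Real.sqrt (y₁ + 1)) := by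
  set F : ℝ → ℝ := fun y => y - 1 / Real.sqrt y * (2 * (1 / Real.sqrt y) - 1 / Real.sqrt (y + 1)) with hF
  have hcont : ContinuousOn F (Set.Icc Y (Y + 1)) := by
    have h1 : ContinuousOn (fun y : ℝ => 1 / Real.sqrt y) (Set.Icc Y (Y + 1)) :=
      continuousOn_const.div Real.continuous_sqrt.continuousOn fun y hy => (Real.sqrt_pos.mpr (by linarith [hy.1])).ne'
    have h2 : ContinuousOn (fun y : ℝ => 1 / Real.sqrt (y + 1)) (Set.Icc Y (Y + 1)) :=
      continuousOn_const.div (Real.continuous_sqrt.comp (continuous_id.add continuous_const)).continuousOn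
        fun y hy => (Real.sqrt_pos.mpr (by linarith [hy.1])).ne'
    exact continuousOn_id.sub (h1.mul ((continuousOn_const.mul h1).sub h2))
  have hFa : F Y ≤ Y := by
    have := (phi_bounds hY).1
    have : 0 < 1 / Y := by positivity
    simp only [hF]; linarith
  have hFb : Y ≤ F (Y + 1) := by
    have := (phi_bounds (show (4 : ℝ) ≤ Y + 1 by linarith)).2
    simp only [hF]; linarith
  obtain ⟨y₁, hy₁, hroot⟩ := intermediate_value_Icc (show Y ≤ Y + 1 by linarith) hcont ⟨hFa, hFb⟩
  exact ⟨y₁, hy₁.1, hy₁.2, by simp only [hF] at hroot; linarith⟩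

/-- **THE RUN.**  For every K and every g ∈ ]0, ½]: couplings g₀ < g₁ < ⋯ < g_K = g in ]0, g] obeying (0.20) for the ramp family, with `Step.Discrete031 (min ½ (g²∕2)) 2 K g g_·`: for k ≥ 2
the levels 1∕g_k² = 1∕g² + (K − k), the scale-1 level is `level_one_exists`' root y₁ (β_2(g₀, g₁) = φ(y₁) ∈ [g²∕2, ½]), the bare level y₁ + 1 (β_1 = 1). [cite: Balaban1987RG1, (0.20) p.256 and (0.31) p.259] -/
theorem rampChain_exists (K : ℕ) {g : ℝ} (hg : 0 < g) (hg1 : g ≤ 1 / 2) :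
    ∃ gs : ℕ → ℝ, gs K = g ∧ RGEqH K S.β gs ∧ (∀ k, k ≤ K → 0 < gs k ∧ gs k ≤ g) ∧
      Step.Discrete031 (min (1 / 2) (g ^ 2 / 2)) 2 K g gs := by
  have hg2 : 0 < 1 / g ^ 2 := by positivity
  have hg4 : 4 ≤ 1 / g ^ 2 := by rw [le_div_iff₀ (by positivity)]; nlinarith
  have hb0 : 0 ≤ min (1 / 2) (g ^ 2 / 2) := le_min (by norm_num) (by positivity)
  have hb1 : min (1 / 2) (g ^ 2 / 2) ≤ 1 / 2 := min_le_left _ _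
  have hbg : min (1 / 2) (g ^ 2 / 2) ≤ g ^ 2 / 2 := min_le_right _ _
  have one_div_sq_sqrt : ∀ {y : ℝ}, 0 < y → 1 / (1 / Real.sqrt y) ^ 2 = y := fun {y} hy => by
    rw [div_pow, one_pow, Real.sq_sqrt hy.le, one_div_one_div]
  have one_div_sqrt_le : ∀ {y : ℝ}, 1 / g ^ 2 ≤ y → 1 / Real.sqrt y ≤ g := fun {y} hy => by
    have h1 : 1 / g ≤ Real.sqrt y := (Real.le_sqrt' (by positivity)).2 (by rw [div_pow, one_pow]; exact hy)
    exact (one_div_le_one_div_of_le (by positivity) h1).trans_eq (one_div_one_div g)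
  set b : ℝ := min (1 / 2) (g ^ 2 / 2) with hb
  clear_value b
  rcases K with _ | _ | K'
  · -- K = 0
    refine ⟨fun _ => g, rfl, fun k hk => absurd hk (Nat.not_lt_zero k), fun k _ => ⟨hg, le_rfl⟩, fun k hk => ?_⟩
    obtain rfl := Nat.le_zero.mp hk; simp
  · -- K = 1: bare level 1/g² + 1
    refine ⟨fun k => if k = 0 then 1 / Real.sqrt (1 / g ^ 2 + 1) else g, by simp, ?_, ?_, ?_⟩
    · intro k hk
      have hk0 : k = 0 := by omega
      subst hk0
      rw [beta_of_ne_one hβ (by norm_num)]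
      simp only [if_true, Nat.zero_add, one_ne_zero, if_false]
      rw [one_div_sq_sqrt (by positivity)]
    · intro k _
      by_cases hk0 : k = 0
      · simp only [hk0, if_true]
        exact ⟨by positivity, one_div_sqrt_le (by linarith)⟩
      · simp only [hk0, if_false]; exact ⟨hg, le_rfl⟩
    · intro k hk
      by_cases hk0 : k = 0
      · subst hk0
        simp only [if_true, Nat.cast_zero, sub_zero]
        rw [one_div_sq_sqrt (by positivity)]
        constructor <;> linarith
      · have hk1 : k = 1 := by omega
        subst hk1
        simp
  · -- K = K' + 2: levels 1/g² + (K' + 2 − k) for k ≥ 2, the IVT root y₁ at scale 1, the bare level y₁ + 1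
    set Y : ℝ := 1 / g ^ 2 + (K' : ℝ) with hY
    have hK'0 : (0 : ℝ) ≤ K' := Nat.cast_nonneg _
    have hY4 : 4 ≤ Y := by linarith
    obtain ⟨y₁, hy₁Y, hy₁Y1, hroot⟩ := level_one_exists hY4
    have hφ := phi_bounds (le_trans hY4 hy₁Y)
    set φ₁ : ℝ := 1 / Real.sqrt y₁ * (2 * (1 / Real.sqrt y₁) - 1 / Real.sqrt (y₁ + 1)) with hφ₁
    clear_value φ₁ Y
    have hy₁pos : 0 < y₁ := by linarith
    have hφpos : 0 < φ₁ := lt_of_lt_of_le (by positivity) hφ.1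
    have hbK : b * (K' : ℝ) ≤ 1 / 2 * K' := mul_le_mul_of_nonneg_right hb1 hK'0
    have hlev : ∀ k : ℕ, 0 < 1 / g ^ 2 + ((K' + 2 - k : ℕ) : ℝ) := fun k => by positivity
    -- the lower constant at scale 1: b(K'+1) ≤ K' + φ₁
    have hk1lo : b * ((K' : ℝ) + 1) ≤ (K' : ℝ) + φ₁ := by
      rcases Nat.eq_zero_or_pos K' with hK' | hK'
      · subst hK'
        have hy₁le : y₁ ≤ 1 / g ^ 2 + 1 := by simpa [hY] using hy₁Y1
        have h1 : g ^ 2 / 2 ≤ 1 / y₁ := by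
          rw [div_le_iff₀ (by norm_num : (0 : ℝ) < 2), div_mul_eq_mul_div, le_div_iff₀ hy₁pos]
          have : y₁ * g ^ 2 ≤ (1 / g ^ 2 + 1) * g ^ 2 := mul_le_mul_of_nonneg_right hy₁le (sq_nonneg g)
          rw [add_mul, one_div_mul_cancel (pow_ne_zero 2 hg.ne')] at this
          nlinarith
        simp only [Nat.cast_zero, zero_add, mul_one]
        linarith [hφ.1]
      · have hK'1 : (1 : ℝ) ≤ K' := by exact_mod_cast hK'
        nlinarith
    let gs : ℕ → ℝ := fun k => if k = 0 then 1 / Real.sqrt (y₁ + 1) else if k = 1 then 1 / Real.sqrt y₁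
      else 1 / Real.sqrt (1 / g ^ 2 + ((K' + 2 - k : ℕ) : ℝ))
    have hgs0 : gs 0 = 1 / Real.sqrt (y₁ + 1) := by simp [gs]
    have hgs1 : gs 1 = 1 / Real.sqrt y₁ := by simp [gs]
    have hgsk : ∀ k, 2 ≤ k → gs k = 1 / Real.sqrt (1 / g ^ 2 + ((K' + 2 - k : ℕ) : ℝ)) := fun k hk => by
      simp [gs, show k ≠ 0 by omega, show k ≠ 1 by omega]
    have e0 : 1 / (gs 0) ^ 2 = y₁ + 1 := by rw [hgs0, one_div_sq_sqrt (by linarith)]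
    have e1 : 1 / (gs 1) ^ 2 = y₁ := by rw [hgs1, one_div_sq_sqrt hy₁pos]
    have ek : ∀ k, 2 ≤ k → 1 / (gs k) ^ 2 = 1 / g ^ 2 + ((K' + 2 - k : ℕ) : ℝ) := fun k hk => by
      rw [hgsk k hk, one_div_sq_sqrt (hlev k)]
    have e2 : 1 / (gs 2) ^ 2 = Y := by rw [ek 2 le_rfl, hY]; norm_num
    have hβ1 : S.β 1 (prefixOf gs 1) = φ₁ := by
      rw [beta_one hβ]
      simp only [FlowStep.prefixOf_apply, Fin.val_one, Fin.val_zero, hgs0, hgs1, hφ₁]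
    refine ⟨gs, ?_, ?_, ?_, ?_⟩
    · -- endpoint
      rw [hgsk (K' + 2) (by omega), Nat.sub_self, Nat.cast_zero, add_zero,
        show (1 : ℝ) / g ^ 2 = (1 / g) ^ 2 by ring, Real.sqrt_sq (by positivity), one_div_one_div]
    · -- (0.20)
      intro k hk
      rcases Nat.lt_or_ge k 2 with hk2 | hk2
      · interval_cases k
        · rw [beta_of_ne_one hβ (by norm_num), e0, e1]
        · rw [hβ1, e1, e2, hroot]
      · rw [beta_of_ne_one hβ (by omega), ek k hk2, ek (k + 1) (by omega)]
        have hnat : K' + 2 - k = (K' + 2 - (k + 1)) + 1 := by omega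
        rw [hnat]; push_cast; ring
    · -- inside ]0, g]
      intro k _
      rcases Nat.lt_or_ge k 2 with hk2 | hk2
      · interval_cases k
        · rw [hgs0]; exact ⟨by positivity, one_div_sqrt_le (by linarith)⟩
        · rw [hgs1]; exact ⟨by positivity, one_div_sqrt_le (by linarith)⟩
      · rw [hgsk k hk2]
        exact ⟨one_div_pos.2 (Real.sqrt_pos.2 (hlev k)), one_div_sqrt_le (by linarith [(Nat.cast_nonneg (K' + 2 - k) : (0 : ℝ) ≤ _)])⟩
    · -- (0.31) with constants (min ½ (g²/2), 2)
      intro k hk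
      rcases Nat.lt_or_ge k 2 with hk2 | hk2
      · interval_cases k
        · rw [e0, hroot, hY]; push_cast
          have e : b * ((K' : ℝ) + 1 + 1 - 0) = b * (K' : ℝ) + 2 * b := by ring
          constructor <;> linarith [hφ.2, hφpos, hbK, hb0, hb1, e]
        · rw [e1, hroot, hY]; push_cast
          have e : b * ((K' : ℝ) + 1 + 1 - 1) = b * ((K' : ℝ) + 1) := by ring
          constructor <;> linarith [hφ.2, hφpos, hk1lo, e, hK'0]
      · rw [ek k hk2, Nat.cast_sub hk]
        have hd : (0 : ℝ) ≤ ((K' + 2 : ℕ) : ℝ) - k := by rw [← Nat.cast_sub hk]; exact Nat.cast_nonneg _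
        have hx : b * (((K' + 2 : ℕ) : ℝ) - k) ≤ 1 * (((K' + 2 : ℕ) : ℝ) - k) :=
          mul_le_mul_of_nonneg_right (by linarith) hd
        constructor <;> linarith

/-- **[I] THEOREM 2 AS TYPED HOLDS** for every setting carrying the ramp family, with the standing hypotheses and the printed `Definitions`: via the row's `theorem2Statement_iff_noInterval`
with g₁ := ½, β := min(½, g²∕2)∕ln L (g-DEPENDENT, as the typing allows — forced by the K = 2 lattice, whose scale-1 window carries β_2 ≈ g²), β′ := 2∕ln L, and `rampChain_exists`
identified with the run from its bare end (`cpl_eq_of_rgEqH`). [cite: Balaban1987RG1, Thm 2 (0.31) p.259 with (0.20) p.256] -/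
theorem theorem2_typed_ramp (hH : StandingHypotheses S) (hD : Definitions S) : Theorem2Statement S (hL_of_standing hH) := by
  have hlog : 0 < Real.log (S.L : ℝ) := Real.log_pos (by exact_mod_cast (hL_of_standing hH).2)
  rw [theorem2Statement_iff_noInterval]
  intro m
  refine ⟨1 / 2, by norm_num, fun g hg hgle => ?_⟩
  have hb0 : 0 < min (1 / 2) (g ^ 2 / 2) := lt_min (by norm_num) (by positivity)
  have hb1 : min (1 / 2) (g ^ 2 / 2) ≤ 2 := (min_le_left _ _).trans (by norm_num)
  refine ⟨min (1 / 2) (g ^ 2 / 2) / Real.log S.L, 2 / Real.log S.L, div_pos hb0 hlog,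
    div_le_div_of_nonneg_right hb1 hlog.le, fun K => ?_⟩
  obtain ⟨gs, hend, hrg', hI, hDisc⟩ := rampChain_exists hβ K hg hgle
  have heq := cpl_eq_of_rgEqH hD (m := m) hrg' fun k hk => (hI k hk).1
  refine ⟨gs 0, fun k hk => by rw [heq k hk]; exact (hI k hk).1, by rw [heq K le_rfl]; exact hend, ?_⟩
  rw [div_mul_cancel₀ _ hlog.ne', div_mul_cancel₀ _ hlog.ne']
  intro k hk
  rw [heq k hk]
  exact hDisc k hk

/-- **THE g-UNIFORM FORM OF (0.31) FAILS** for every such setting with the printed `Definitions` (and L > 1): else part 6's END `betaAFH_of_uniformTheorem2_fadingMemory` (with the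
letters of §1 on ]0, ½]: `hrg`, (U), `HistLipschitz` with `FadingMemory 5 (1∕2)`) would give `BetaAFH S.β`, hence `BetaSignH S.β` — refuted by `not_betaSignH_ramp`.
[cite: Balaban1987RG1, Thm 2 (0.31) p.259] -/
theorem not_uniform_ramp (hD : Definitions S) (hL1 : 1 < S.L) :
    ¬ ∀ m : ℕ, ∃ γ₀ : ℝ, 0 < γ₀ ∧ ∀ γ : ℝ, 0 < γ → γ ≤ γ₀ → ∃ g₁ : ℝ, 0 < g₁ ∧ ∃ β β' : ℝ, 0 < β ∧ β ≤ β' ∧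
        ∀ g : ℝ, 0 < g → g ≤ g₁ → ∀ K : ℕ, ∃ g₀ : ℝ, Step.InInterval γ K (S.cpl ⟨K, m, g₀⟩) ∧ S.cpl ⟨K, m, g₀⟩ K = g ∧
          Step.Discrete031 (β * Real.log S.L) (β' * Real.log S.L) K g (S.cpl ⟨K, m, g₀⟩) := by
  intro hTu
  obtain ⟨hU, -, -, hrg⟩ := letters_ramp hβ
  have hΛ := fadingMemory_ramp (γ := 1 / 2) (θ := 1 / 2) (by norm_num) (by norm_num) (by norm_num)
  exact not_betaSignH_ramp hβ (betaSignH_of_AFH (betaAFH_of_uniformTheorem2_fadingMemory hD hTu 0 hL1 (by norm_num : (0 : ℝ) < 1 / 2)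
    (by norm_num : (0 : ℝ) < 1 / 2) (by norm_num) (by norm_num) (hrg hD) hU (histLipschitz_ramp hβ (by norm_num)) hΛ))

/-- **UNIQUENESS IS FREE** (part 7 `localUnique_signFree` at the ramp family's moduli): with the printed `Definitions` there is g₂ > 0 such that in-]0, g₂]-interval runs of the same length
with a common renormalized coupling have the same bare coupling. [cite: Balaban1987RG1, Thm 2 p.259 («g₀ = g₀(ε, g)») with (0.18)–(0.20) pp.255–256] -/
theorem localUnique_ramp (hD : Definitions S) (m : ℕ) :
    ∃ g₂ : ℝ, 0 < g₂ ∧ ∀ (K : ℕ) (g₀ g₀' : ℝ), Step.InInterval g₂ K (S.cpl ⟨K, m, g₀⟩) →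
      Step.InInterval g₂ K (S.cpl ⟨K, m, g₀'⟩) → S.cpl ⟨K, m, g₀⟩ K = S.cpl ⟨K, m, g₀'⟩ K → g₀ = g₀' := by
  obtain ⟨-, -, -, hrg⟩ := letters_ramp hβ
  have hΛ := fadingMemory_ramp (γ := 1 / 2) (θ := 1 / 2) (by norm_num) (by norm_num) (by norm_num)
  exact localUnique_signFree hD (m := m) (by norm_num) (by norm_num) (by norm_num) (by norm_num : (0 : ℝ) < 1 / 2) (hrg hD)
    (histLipschitz_ramp hβ (by norm_num)) hΛ

end Family

end

end Summit.QuantumFields.BalabanUV.Beta.EriceFlowEnclosureB12AsPrintedPointwiseFadingSignFamily
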